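import Literature.NumberTheory.Automorphic.ArchRankOneOrbitalFamilyParamCayley     -- ★ p851143 (this seat) (B-par) on `U(J)`, GLOBAL class: `contDiffOn_cayley_orbitalIntegral_param`, `fderiv_cayley_orbitalIntegral_param[_prod]_apply`, `fderiv_splitIntegral_param_prod_apply`; brings ★ p851042, ★ p851003
import Literature.Analysis.Calculus.ParametricFamilyLocalisation                   -- (this seat) generic: `exists_contDiff_uncurry_eventuallyEq_of_contDiffOn` (localisation), `contDiffOn_uncurry_fderiv_apply_of_isOpen`, `forall_fderiv_apply_eq_zero_of_support_isOpen`
import HarnessLib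

/-!
# (B-par) FOR FAMILIES SMOOTH ON AN OPEN PARAMETER SET — the reader sockets `h1 ∕ h2 ∕ hcl` of ★ p851048 ∕ ★ (corner readers) for the class «`ContDiffOn ℝ ∞ (uncurry Θ) (O ×ˢ univ)`,
# one compact support on `O`»: the `U(J)`-Cayley normalised elliptic functional and the split half-chart functional (Harish-Chandra ∕ Varadarajan 1977 I §1.12; Hörmander 1.1.8–1.1.9)

Topic `NumberTheory/Automorphic`; namespace `Literature.NumberTheory.Automorphic.UnitaryGroup`.  THEOREMS ONLY (no `def`, no instance, no notation, no axiom, no named fact, no `sorry`);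
kernel lane `--kind proof --supports stmt-HodgeConjecture-24833`.  Cell `pub/hodgecm-mathlib`, crux H413 (`stmt-HodgeConjecture-24833`), line LH3 (closer stub `stub_N9`), LETTER L1
clause (I₁) at the X′-CORNERS (organ O-L1e of leaf v5), brick **(X3-rk1) (ii)** «the OPEN-PARAMETER-SET twin of ★ p851042∕p851143» (F0P3a-p02 (g21)'s split 2026-09-02T11:00:14Z
under LH3-plan (g4) RULING #18; author F0P3a-p04 (g24)).  WHY: the nested corner readers of (X3) differentiate families `(q, ψ₂) ↦ (X₁ ↦ Φ₂(Θ_q(X₁, ·))(ψ₂))` that are smooth only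
for `ψ₂` in the OPEN punctured interval; the sockets of ★ `exists_forall_norm_iteratedFDeriv_reader_le_of_uniform_on` (F0P3a-p02) and of ★ p851048 quantify over an admissible class
and an open parameter set `Q`, so the class must be the OPEN one.

THE MATHEMATICS.  Nothing new analytically: every statement is POINTWISE-LOCAL in the parameter, and a family of the open class agrees near each `q₀ ∈ O` with a family of the
GLOBAL class of ★ p851143 having the SAME compact support (★ generic localisation `exists_contDiff_uncurry_eventuallyEq_of_contDiffOn`: multiply by a cut-off `χ(q)`, `χ = 1`
near `q₀`, `tsupport χ ⊆ O`); `ContDiffAt` and `fderiv` at `(q₀, ψ)` then transfer along the eventual equality (`ContDiffAt.congr_of_eventuallyEq`, `Filter.EventuallyEq.fderiv_eq`),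
and `∂_v Θ′(q₀) = ∂_v Θ(q₀)` likewise.  The carrier, the Cayley torus text `hF` (★ (K0±) p850353's, centre `z`), the split half-chart text `hΛ` (★ p851042's, angle `θ`) and the
measures are those of ★ p851143 VERBATIM.
* §1 elliptic: **`contDiffOn_cayley_orbitalIntegral_param_of_isOpen`** (`(q, ψ) ↦ F(Θ_q)(ψ)` is `C^∞` on `O ×ˢ {sin ψ ≠ 0}` — the `h1` socket with `Q := O`, `T ⊆ {sin ≠ 0}`),
  **`fderiv_cayley_orbitalIntegral_param_apply_of_mem_isOpen`** (`∂_v [q ↦ F(Θ_q)(ψ)](q) = F(∂_v Θ_q)(ψ)`, `q ∈ O`, every `ψ`),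
  **`fderiv_cayley_orbitalIntegral_param_prod_apply_of_isOpen`** (the JOINT `(v, 0)` form — the `h2` socket).
* §2 split: **`contDiffOn_splitIntegral_param_of_isOpen`** (`C^∞` on `O ×ˢ univ`), **`fderiv_splitIntegral_param_prod_apply_of_isOpen`**.
* §3 the open class is closed under `D v g := fun q X => fderiv ℝ (fun q′ => g q′ X) q v`: **`openFamily_fderiv_closed`** (packages ★ `contDiffOn_uncurry_fderiv_apply_of_isOpen` +
  ★ `forall_fderiv_apply_eq_zero_of_support_isOpen` as the `hcl` socket).
HONEST LABEL: HC_CM is proved only modulo the 7 printed citations (2 remaining named inputs: hLiu418 = `stmt-HodgeConjecture-24832`, h413 = `stmt-HodgeConjecture-24833`) until rung 0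
closes; localisation bookkeeping over ★ p851143, count-neutral (letter-L1 (I₁)-corner brick; pays nothing by itself).

## References
* [Varadarajan1977] V. S. Varadarajan, *Harmonic Analysis on Real Reductive Groups*, LNM 576 (1977), Part I §1.12.
* [HormanderALPDO1] L. Hörmander, *The Analysis of Linear Partial Differential Operators I*, 2nd ed. (1990), §1.1 Thm. 1.1.8–1.1.9, §1.4 Thm. 1.4.1.
* [Rogawski1990] J. D. Rogawski, *Automorphic Representations of Unitary Groups in Three Variables*, Ann. of Math. Stud. 123 (1990), §8.2 pp. 119–123.
* [Bouaziz1994IntegralesOrbitales] A. Bouaziz, *Intégrales orbitales sur les groupes de Lie réductifs*, Ann. Sci. ÉNS 27 (1994), §3.1–3.2 ((I₁)–(I₃)).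
-/

set_option autoImplicit false

noncomputable section

namespace Literature.NumberTheory.Automorphic

namespace UnitaryGroup

open _root_.MeasureTheory _root_.MeasureTheory.Measure _root_.Set _root_.Filter _root_.Topology _root_.Complex
open _root_.Literature.Analysis.Calculus _root_.Literature.NumberTheory.Automorphic.RankOneCasimir
open scoped MatrixGroups ContDiff ComplexConjugate
open scoped Matrix.Norms.Operator

variable {J : Matrix (Fin 2) (Fin 2) ℂ} (hJ : J = (StdForm.antidiagonal 2).over ℂ)
  [MeasurableSpace ↥(unitaryGroupOfForm (starRingEnd ℂ) J)] [BorelSpace ↥(unitaryGroupOfForm (starRingEnd ℂ) J)]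
  {E : Type*} [NormedAddCommGroup E] [NormedSpace ℝ E] [CompleteSpace E]
  {Q : Type*} [NormedAddCommGroup Q] [NormedSpace ℝ Q] [FiniteDimensional ℝ Q]

/-! ## §1 The `U(J)`-Cayley normalised elliptic functional on an open-set family -/

include hJ in
/-- **`h1` FOR THE OPEN CLASS: `(q, ψ) ↦ F(Θ_q)(ψ)` is `C^∞` on `O ×ˢ {sin ψ ≠ 0}`** for `Θ` with `ContDiffOn ℝ ∞ (uncurry Θ) (O ×ˢ univ)` (`O` open) and one compact support on `O`
(★ p851143 `contDiffOn_cayley_orbitalIntegral_param` for the localised global family, transferred along the eventual equality). [cite: Varadarajan1977, I §1.12]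
[cite: HormanderALPDO1, Thm. 1.1.9, Thm. 1.4.1] -/
theorem contDiffOn_cayley_orbitalIntegral_param_of_isOpen (μ : Measure ↥(unitaryGroupOfForm (starRingEnd ℂ) J)) [IsFiniteMeasureOnCompacts μ]
    (z : Circle) (F : (Matrix (Fin 2) (Fin 2) ℂ → E) → ℝ → E)
    (hF : ∀ (f : Matrix (Fin 2) (Fin 2) ℂ → E) (ψ : ℝ), F f ψ = (2 * Real.sin ψ) •
      ∫ h : ↥(unitaryGroupOfForm (starRingEnd ℂ) J),
        f (((h * ⟨Matrix.GeneralLinearGroup.mkOfDetNeZero !![(1 : ℂ), 1; 1, -1] det_cayleyTwo_ne_zero *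
              circleDiagonal 2 ![z * Circle.exp ψ, z * Circle.exp (-ψ)] * (Matrix.GeneralLinearGroup.mkOfDetNeZero !![(1 : ℂ), 1; 1, -1] det_cayleyTwo_ne_zero)⁻¹,
            cayley_conj_circleDiagonal_mem_of_eq_over hJ _⟩ * h⁻¹ : ↥(unitaryGroupOfForm (starRingEnd ℂ) J)) : GL (Fin 2) ℂ) : Matrix (Fin 2) (Fin 2) ℂ) ∂μ)
    {O : Set Q} (hO : IsOpen O) (Θ : Q → Matrix (Fin 2) (Fin 2) ℂ → E) (hΘ : ContDiffOn ℝ ∞ (Function.uncurry Θ) (O ×ˢ (univ : Set (Matrix (Fin 2) (Fin 2) ℂ))))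
    (hΘc : ∃ C : Set (Matrix (Fin 2) (Fin 2) ℂ), IsCompact C ∧ ∀ q ∈ O, ∀ X : Matrix (Fin 2) (Fin 2) ℂ, X ∉ C → Θ q X = 0) :
    ContDiffOn ℝ ∞ (fun x : Q × ℝ => F (Θ x.1) x.2) (O ×ˢ {ψ : ℝ | Real.sin ψ ≠ 0}) := by
  obtain ⟨C, hC, h0⟩ := hΘc
  have hU : IsOpen ((Set.univ : Set Q) ×ˢ {ψ : ℝ | Real.sin ψ ≠ 0}) := isOpen_univ.prod (isOpen_ne_fun Real.continuous_sin continuous_const)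
  intro x hx
  obtain ⟨hxO, hxs⟩ := Set.mem_prod.1 hx
  obtain ⟨Θ', hΘ', h0', hev⟩ := exists_contDiff_uncurry_eventuallyEq_of_contDiffOn hO hΘ h0 hxO
  have key := (contDiffOn_cayley_orbitalIntegral_param hJ μ z F hF Θ' hΘ' ⟨C, hC, h0'⟩).contDiffAt (x := x) (hU.mem_nhds (Set.mem_prod.2 ⟨Set.mem_univ _, hxs⟩))
  have hev' : (fun y : Q × ℝ => F (Θ y.1) y.2) =ᶠ[𝓝 x] fun y : Q × ℝ => F (Θ' y.1) y.2 :=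
    ((continuous_fst.tendsto x).eventually hev).mono fun y hy => by
      show F (Θ y.1) y.2 = F (Θ' y.1) y.2
      rw [hy]
  exact (key.congr_of_eventuallyEq hev').contDiffWithinAt

omit [CompleteSpace E] in
include hJ in
/-- **`∂_v` INSIDE, OPEN CLASS: `∂_v [q ↦ F(Θ_q)(ψ)](q) = F(∂_v Θ_q)(ψ)` for `q ∈ O` and EVERY `ψ`** (★ p851143 `fderiv_cayley_orbitalIntegral_param_apply` for the localised family;
`∂_v Θ′(q) = ∂_v Θ(q)` since the families agree near `q`). [cite: Varadarajan1977, I §1.12] [cite: HormanderALPDO1, Thm. 1.1.9] -/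
theorem fderiv_cayley_orbitalIntegral_param_apply_of_mem_isOpen (μ : Measure ↥(unitaryGroupOfForm (starRingEnd ℂ) J)) [IsFiniteMeasureOnCompacts μ]
    (z : Circle) (F : (Matrix (Fin 2) (Fin 2) ℂ → E) → ℝ → E)
    (hF : ∀ (f : Matrix (Fin 2) (Fin 2) ℂ → E) (ψ : ℝ), F f ψ = (2 * Real.sin ψ) •
      ∫ h : ↥(unitaryGroupOfForm (starRingEnd ℂ) J),
        f (((h * ⟨Matrix.GeneralLinearGroup.mkOfDetNeZero !![(1 : ℂ), 1; 1, -1] det_cayleyTwo_ne_zero *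
              circleDiagonal 2 ![z * Circle.exp ψ, z * Circle.exp (-ψ)] * (Matrix.GeneralLinearGroup.mkOfDetNeZero !![(1 : ℂ), 1; 1, -1] det_cayleyTwo_ne_zero)⁻¹,
            cayley_conj_circleDiagonal_mem_of_eq_over hJ _⟩ * h⁻¹ : ↥(unitaryGroupOfForm (starRingEnd ℂ) J)) : GL (Fin 2) ℂ) : Matrix (Fin 2) (Fin 2) ℂ) ∂μ)
    {O : Set Q} (hO : IsOpen O) (Θ : Q → Matrix (Fin 2) (Fin 2) ℂ → E) (hΘ : ContDiffOn ℝ ∞ (Function.uncurry Θ) (O ×ˢ (univ : Set (Matrix (Fin 2) (Fin 2) ℂ))))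
    (hΘc : ∃ C : Set (Matrix (Fin 2) (Fin 2) ℂ), IsCompact C ∧ ∀ q ∈ O, ∀ X : Matrix (Fin 2) (Fin 2) ℂ, X ∉ C → Θ q X = 0)
    {q : Q} (hq : q ∈ O) (v : Q) (ψ : ℝ) :
    fderiv ℝ (fun q' : Q => F (Θ q') ψ) q v = F (fun X => fderiv ℝ (fun q' : Q => Θ q' X) q v) ψ := by
  obtain ⟨C, hC, h0⟩ := hΘc
  obtain ⟨Θ', hΘ', h0', hev⟩ := exists_contDiff_uncurry_eventuallyEq_of_contDiffOn hO hΘ h0 hq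
  have hev' : (fun q' : Q => F (Θ q') ψ) =ᶠ[𝓝 q] fun q' : Q => F (Θ' q') ψ := hev.mono fun q' hq' => by
    show F (Θ q') ψ = F (Θ' q') ψ
    rw [hq']
  have hD : (fun X => fderiv ℝ (fun q' : Q => Θ' q' X) q v) = fun X => fderiv ℝ (fun q' : Q => Θ q' X) q v :=
    funext fun X => by rw [Filter.EventuallyEq.fderiv_eq (hev.mono fun q' hq' => show Θ' q' X = Θ q' X by rw [hq'])]
  rw [hev'.fderiv_eq, fderiv_cayley_orbitalIntegral_param_apply hJ μ z F hF Θ' hΘ' ⟨C, hC, h0'⟩ q v ψ, hD]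

include hJ in
/-- **`h2` FOR THE OPEN CLASS (joint `(v, 0)` form): at `x ∈ O ×ˢ {sin ≠ 0}`, `D[(q, ψ) ↦ F(Θ_q)(ψ)](x)·(v, 0) = F(∂_v Θ_{x.1})(x.2)`** (★ generic `fderiv_slice_fst_apply` + §1).
[cite: Varadarajan1977, I §1.12] [cite: HormanderALPDO1, Thm. 1.1.9] -/
theorem fderiv_cayley_orbitalIntegral_param_prod_apply_of_isOpen (μ : Measure ↥(unitaryGroupOfForm (starRingEnd ℂ) J)) [IsFiniteMeasureOnCompacts μ]
    (z : Circle) (F : (Matrix (Fin 2) (Fin 2) ℂ → E) → ℝ → E)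
    (hF : ∀ (f : Matrix (Fin 2) (Fin 2) ℂ → E) (ψ : ℝ), F f ψ = (2 * Real.sin ψ) •
      ∫ h : ↥(unitaryGroupOfForm (starRingEnd ℂ) J),
        f (((h * ⟨Matrix.GeneralLinearGroup.mkOfDetNeZero !![(1 : ℂ), 1; 1, -1] det_cayleyTwo_ne_zero *
              circleDiagonal 2 ![z * Circle.exp ψ, z * Circle.exp (-ψ)] * (Matrix.GeneralLinearGroup.mkOfDetNeZero !![(1 : ℂ), 1; 1, -1] det_cayleyTwo_ne_zero)⁻¹,
            cayley_conj_circleDiagonal_mem_of_eq_over hJ _⟩ * h⁻¹ : ↥(unitaryGroupOfForm (starRingEnd ℂ) J)) : GL (Fin 2) ℂ) : Matrix (Fin 2) (Fin 2) ℂ) ∂μ)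
    {O : Set Q} (hO : IsOpen O) (Θ : Q → Matrix (Fin 2) (Fin 2) ℂ → E) (hΘ : ContDiffOn ℝ ∞ (Function.uncurry Θ) (O ×ˢ (univ : Set (Matrix (Fin 2) (Fin 2) ℂ))))
    (hΘc : ∃ C : Set (Matrix (Fin 2) (Fin 2) ℂ), IsCompact C ∧ ∀ q ∈ O, ∀ X : Matrix (Fin 2) (Fin 2) ℂ, X ∉ C → Θ q X = 0)
    (v : Q) {x : Q × ℝ} (hx : x ∈ O ×ˢ {ψ : ℝ | Real.sin ψ ≠ 0}) :
    fderiv ℝ (fun y : Q × ℝ => F (Θ y.1) y.2) x (v, (0 : ℝ)) = F (fun X => fderiv ℝ (fun q' : Q => Θ q' X) x.1 v) x.2 := by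
  have hO' : IsOpen (O ×ˢ {ψ : ℝ | Real.sin ψ ≠ 0}) := hO.prod (isOpen_ne_fun Real.continuous_sin continuous_const)
  have hd : DifferentiableAt ℝ (fun y : Q × ℝ => F (Θ y.1) y.2) x :=
    ((contDiffOn_cayley_orbitalIntegral_param_of_isOpen hJ μ z F hF hO Θ hΘ hΘc).contDiffAt (hO'.mem_nhds hx)).differentiableAt (by simp)
  rw [← fderiv_slice_fst_apply hd v]
  exact fderiv_cayley_orbitalIntegral_param_apply_of_mem_isOpen hJ μ z F hF hO Θ hΘ hΘc (Set.mem_prod.1 hx).1 v x.2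

/-! ## §2 The split half-chart functional on an open-set family -/

include hJ in
/-- **`h1` FOR THE OPEN CLASS, SPLIT READER: `(q, x) ↦ Λ(Θ_q)(x)` is `C^∞` on `O ×ˢ univ`** (★ p851042 `contDiff_splitIntegral_param` for the localised family). [cite: Varadarajan1977, I §1.12]
[cite: HormanderALPDO1, Thm. 1.1.9, Thm. 1.4.1] -/
theorem contDiffOn_splitIntegral_param_of_isOpen {K : Subgroup ↥(unitaryGroupOfForm (starRingEnd ℂ) J)} (κ : Measure ↥K) (μN : Measure ↥(unipotentU (starRingEnd ℂ) J))
    (hK : IsCompact (K : Set ↥(unitaryGroupOfForm (starRingEnd ℂ) J))) [κ.IsHaarMeasure] [μN.IsHaarMeasure]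
    (θ : ℝ) (Λ : (Matrix (Fin 2) (Fin 2) ℂ → E) → ℝ → E)
    (hΛ : ∀ (g : Matrix (Fin 2) (Fin 2) ℂ → E) (x : ℝ), Λ g x = ∫ p : ↥K × ↥(unipotentU (starRingEnd ℂ) J), g ((((((p.1 : ↥K) : ↥(unitaryGroupOfForm (starRingEnd ℂ) J)) * (((⟨hypBlockGL 0 θ, hypBlockGL_mem_of_eq_over hJ 0 θ⟩ : ↥(unitaryGroupOfForm (starRingEnd ℂ) J))) * ((⟨hypBlockGL (x / 2) 0, hypBlockGL_mem_of_eq_over hJ (x / 2) 0⟩ : ↥(unitaryGroupOfForm (starRingEnd ℂ) J))) * ((p.2 : ↥(unipotentU (starRingEnd ℂ) J)) : ↥(unitaryGroupOfForm (starRingEnd ℂ) J)) * ((⟨hypBlockGL (x / 2) 0, hypBlockGL_mem_of_eq_over hJ (x / 2) 0⟩ : ↥(unitaryGroupOfForm (starRingEnd ℂ) J)))) * ((p.1 : ↥K) : ↥(unitaryGroupOfForm (starRingEnd ℂ) J))⁻¹ : ↥(unitaryGroupOfForm (starRingEnd ℂ) J))) : GL (Fin 2) ℂ) : Matrix (Fin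 2) (Fin 2) ℂ) ∂(κ.prod μN))
    {O : Set Q} (hO : IsOpen O) (Θ : Q → Matrix (Fin 2) (Fin 2) ℂ → E) (hΘ : ContDiffOn ℝ ∞ (Function.uncurry Θ) (O ×ˢ (univ : Set (Matrix (Fin 2) (Fin 2) ℂ))))
    (hΘc : ∃ C : Set (Matrix (Fin 2) (Fin 2) ℂ), IsCompact C ∧ ∀ q ∈ O, ∀ X : Matrix (Fin 2) (Fin 2) ℂ, X ∉ C → Θ q X = 0) :
    ContDiffOn ℝ ∞ (fun x : Q × ℝ => Λ (Θ x.1) x.2) (O ×ˢ (univ : Set ℝ)) := by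
  obtain ⟨C, hC, h0⟩ := hΘc
  intro x hx
  obtain ⟨hxO, -⟩ := Set.mem_prod.1 hx
  obtain ⟨Θ', hΘ', h0', hev⟩ := exists_contDiff_uncurry_eventuallyEq_of_contDiffOn hO hΘ h0 hxO
  have key := (contDiff_splitIntegral_param hJ κ μN hK θ Λ hΛ Θ' hΘ' ⟨C, hC, h0'⟩).contDiffAt (x := x)
  have hev' : (fun y : Q × ℝ => Λ (Θ y.1) y.2) =ᶠ[𝓝 x] fun y : Q × ℝ => Λ (Θ' y.1) y.2 :=
    ((continuous_fst.tendsto x).eventually hev).mono fun y hy => by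
      show Λ (Θ y.1) y.2 = Λ (Θ' y.1) y.2
      rw [hy]
  exact (key.congr_of_eventuallyEq hev').contDiffWithinAt

include hJ in
/-- **`h2` FOR THE OPEN CLASS, SPLIT READER (joint `(v, 0)` form): at `x ∈ O ×ˢ univ`, `D[(q, x₀) ↦ Λ(Θ_q)(x₀)](x)·(v, 0) = Λ(∂_v Θ_{x.1})(x.2)`** (★ p851042
`fderiv_splitIntegral_param_apply` for the localised family + ★ generic `fderiv_slice_fst_apply`). [cite: Varadarajan1977, I §1.12] [cite: HormanderALPDO1, Thm. 1.1.9] -/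
theorem fderiv_splitIntegral_param_prod_apply_of_isOpen {K : Subgroup ↥(unitaryGroupOfForm (starRingEnd ℂ) J)} (κ : Measure ↥K) (μN : Measure ↥(unipotentU (starRingEnd ℂ) J))
    (hK : IsCompact (K : Set ↥(unitaryGroupOfForm (starRingEnd ℂ) J))) [κ.IsHaarMeasure] [μN.IsHaarMeasure]
    (θ : ℝ) (Λ : (Matrix (Fin 2) (Fin 2) ℂ → E) → ℝ → E)
    (hΛ : ∀ (g : Matrix (Fin 2) (Fin 2) ℂ → E) (x : ℝ), Λ g x = ∫ p : ↥K × ↥(unipotentU (starRingEnd ℂ) J), g ((((((p.1 : ↥K) : ↥(unitaryGroupOfForm (starRingEnd ℂ) J)) * (((⟨hypBlockGL 0 θ, hypBlockGL_mem_of_eq_over hJ 0 θ⟩ : ↥(unitaryGroupOfForm (starRingEnd ℂ) J))) * ((⟨hypBlockGL (x / 2) 0, hypBlockGL_mem_of_eq_over hJ (x / 2) 0⟩ : ↥(unitaryGroupOfForm (starRingEnd ℂ) J))) * ((p.2 : ↥(unipotentU (starRingEnd ℂ) J)) : ↥(unitaryGroupOfForm (starRingEnd ℂ) J)) * ((⟨hypBlockGL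 (x / 2) 0, hypBlockGL_mem_of_eq_over hJ (x / 2) 0⟩ : ↥(unitaryGroupOfForm (starRingEnd ℂ) J)))) * ((p.1 : ↥K) : ↥(unitaryGroupOfForm (starRingEnd ℂ) J))⁻¹ : ↥(unitaryGroupOfForm (starRingEnd ℂ) J))) : GL (Fin 2) ℂ) : Matrix (Fin 2) (Fin 2) ℂ) ∂(κ.prod μN))
    {O : Set Q} (hO : IsOpen O) (Θ : Q → Matrix (Fin 2) (Fin 2) ℂ → E) (hΘ : ContDiffOn ℝ ∞ (Function.uncurry Θ) (O ×ˢ (univ : Set (Matrix (Fin 2) (Fin 2) ℂ))))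
    (hΘc : ∃ C : Set (Matrix (Fin 2) (Fin 2) ℂ), IsCompact C ∧ ∀ q ∈ O, ∀ X : Matrix (Fin 2) (Fin 2) ℂ, X ∉ C → Θ q X = 0)
    (v : Q) {x : Q × ℝ} (hx : x ∈ O ×ˢ (univ : Set ℝ)) :
    fderiv ℝ (fun y : Q × ℝ => Λ (Θ y.1) y.2) x (v, (0 : ℝ)) = Λ (fun X => fderiv ℝ (fun q' : Q => Θ q' X) x.1 v) x.2 := by
  obtain ⟨C, hC, h0⟩ := hΘc
  obtain ⟨hxO, -⟩ := Set.mem_prod.1 hx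
  obtain ⟨Θ', hΘ', h0', hev⟩ := exists_contDiff_uncurry_eventuallyEq_of_contDiffOn hO hΘ h0 hxO
  have hev' : (fun y : Q × ℝ => Λ (Θ y.1) y.2) =ᶠ[𝓝 x] fun y : Q × ℝ => Λ (Θ' y.1) y.2 :=
    ((continuous_fst.tendsto x).eventually hev).mono fun y hy => by
      show Λ (Θ y.1) y.2 = Λ (Θ' y.1) y.2
      rw [hy]
  have hD : (fun X => fderiv ℝ (fun q' : Q => Θ' q' X) x.1 v) = fun X => fderiv ℝ (fun q' : Q => Θ q' X) x.1 v :=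
    funext fun X => by rw [Filter.EventuallyEq.fderiv_eq (hev.mono fun q' hq' => show Θ' q' X = Θ q' X by rw [hq'])]
  rw [hev'.fderiv_eq, fderiv_splitIntegral_param_prod_apply hJ κ μN hK θ Λ hΛ Θ' hΘ' ⟨C, hC, h0'⟩ v x, hD]

/-! ## §3 The open class is closed under the transversal parameter derivative (the `hcl` socket) -/

omit hJ [MeasurableSpace ↥(unitaryGroupOfForm (starRingEnd ℂ) J)] [BorelSpace ↥(unitaryGroupOfForm (starRingEnd ℂ) J)] [CompleteSpace E] [FiniteDimensional ℝ Q] in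
/-- **`hcl` FOR THE OPEN CLASS**: if `g` is `C^∞` on `O ×ˢ univ` (`O` open) with one compact support `C` on `O`, so is `D v g := fun q X => fderiv ℝ (fun q′ => g q′ X) q v`, with the SAME
`C` (★ generic `contDiffOn_uncurry_fderiv_apply_of_isOpen`, `forall_fderiv_apply_eq_zero_of_support_isOpen`). [cite: HormanderALPDO1, §1.1 Thm. 1.1.8] -/
theorem openFamily_fderiv_closed {M : Type*} [NormedAddCommGroup M] [NormedSpace ℝ M] {O : Set Q} (hO : IsOpen O) {g : Q → M → E}
    (hg : ContDiffOn ℝ ∞ (Function.uncurry g) (O ×ˢ (univ : Set M)) ∧ ∃ C : Set M, IsCompact C ∧ ∀ q ∈ O, ∀ X : M, X ∉ C → g q X = 0) (v : Q) :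
    ContDiffOn ℝ ∞ (Function.uncurry fun (q : Q) (X : M) => fderiv ℝ (fun q' : Q => g q' X) q v) (O ×ˢ (univ : Set M)) ∧
      ∃ C : Set M, IsCompact C ∧ ∀ q ∈ O, ∀ X : M, X ∉ C → fderiv ℝ (fun q' : Q => g q' X) q v = 0 := by
  obtain ⟨hg1, C, hC, h0⟩ := hg
  exact ⟨contDiffOn_uncurry_fderiv_apply_of_isOpen hO hg1 v, C, hC, forall_fderiv_apply_eq_zero_of_support_isOpen hO h0 v⟩

end UnitaryGroup

end Literature.NumberTheory.Automorphic

end
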